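import Summits.AtomisticToContinuum.BoseEinsteinCondensation.Theses.BECDyadicChaining

/-!
# Birth skeleton — crux `DyadicCoherenceDefect` (stmt-AtomisticToContinuum-13192), route `BECDyadicChaining`

`Lines/birth.lean` of the crux (BC3 of the Lean birth certificate; skeleton registrar, 2026-08-17).
The crux (rank 2 of `route-AtomisticToContinuum-BECDyadicChaining`): for every repulsive finite-range
`v` there are `ℓ_d > 0`, `ρ₀ > 0` such that for `0 < ρ < ρ₀` ONE budget `β : ℕ → [0,∞)`,
`Σ_j β_j ≤ 1/4`, controls, for all large `N`, some `δ > 0` and every `δ`-near-minimiser `Ψ` of the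
Dirichlet box of side `L = (N/ρ)^{1/3}`, the per-level COHERENCE DEFECT of the dyadic block
condensates: `A_m ≤ A_{m-1} + β_j √N` whenever the cube side `L/2^m` lies in the bracket
`[ℓ_d 2^j, ℓ_d 2^{j+1})`, where `A_m = 8^{-m/2} Σ_{C ∈ level m} √⟨φ_C, γ_Ψ φ_C⟩`.

## The line (the route's own TWO-LAYER PLAN, typed): regime split at the Fournais–Junge window

Write `a = scatteringLength v` and `s_w(ρ, η) = (ρa)^{-1/2} (ρa³)^{-η}` (`0 < η < 1/4`) for the top of
the local-condensation window. Four named stubs: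

* `stub_defectAboveWindow` — `DefectAboveWindow` (XL / open; the HARDEST stub, the rank-2 content):
  for SOME window exponent `η ∈ (0, 1/4)` and every bracket base `ℓ_d > 0`, a summable budget
  `Σ β ≤ 1/8` for the levels whose cube side EXCEEDS `s_w(ρ, η)` (inter-octant phase coherence of the
  Dirichlet near-minimisers on the scales above the window; no engine in print — Junge2026 Rem. 7).
* `stub_levelIncrement` — `LevelIncrement` (M, provable now; Hilbert-space geometry of the Gram
  vectors `u_C ∈ L²(Λ^{N-1})`, `occupation = N‖u_C‖²`, `u_P = 8^{-1/2} Σ_{C ⊂ P} u_C`): with the level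
  occupations `T_m = Σ_{C ∈ level m} ⟨φ_C, γ_Ψ φ_C⟩` one has `T_{m-1} ≤ T_m ≤ N` (in the tree for the
  half-open cells: `cohSum_le_cohSum_succ`, `cohSum_le_card`, bridge `openCell_ae_eq_dyCell`) and the
  NEW inequality `A_m ≤ A_{m-1} + √(T_m − T_{m-1})` (per parent `Σ_C‖u_C‖ − ‖Σ_C u_C‖ ≤ √(8 Σ_C‖u_C‖²) −
  √(8·8‖u_P‖²)/… ≤ √(8(Σ_C n_C − n_P))`, i.e. `√x − √y ≤ √(x − y)`, then Cauchy–Schwarz over the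
  `8^{m-1}` parents: `8^{-m/2} Σ_P √(8(M_P − n_P)) ≤ √(T_m − T_{m-1})`).
* `stub_windowLocalCondensation` — the route's own rank-4 item `BECDyadicChaining.WindowLocalCondensation`
  (stmt-AtomisticToContinuum-13194) BY NAME (XL; Fournais2020 Thm 1.2 / Junge2026 Cor. 6 technology):
  `T_m ≥ (1 − C(ρa³)^γ max(1, ρ a s_m²)) N` on every level with `s_m = L/2^m ≤ s_w(ρ, η)`, `γ > 2η`.
* `stub_windowBudget` — `WindowBudget : LevelIncrement → WindowLocalCondensation → DefectInWindow`
  (M/L, bookkeeping with teeth): inside the window the defect of level `m` is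
  `≤ √(T_m − T_{m-1}) ≤ √(N − T_{m-1}) ≤ √(C'(ρa³)^{γ'} max(1, 4ρ a s_m²)) √N` (WindowLocalCondensation
  at a second exponent `η' ∈ (η, 1/4)` so that level `m − 1` is still in the `η'`-window once
  `(ρa³)^{-(η'−η)} ≥ 2`), so `β_j := √(C'(ρa³)^{γ'} max(1, 16 ρ a ℓ_d² 4^j))·[ℓ_d 2^j ≤ s_w]` is a
  budget with `Σ_j β_j ≲ √C' (ρa³)^{γ'/2} (log₂(s_w/ℓ_d) + 1 + 8(ρa³)^{-η}) → 0` (`γ' > 2η' > 2η`),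
  hence `≤ 1/8` for `ρ < ρ₀(v, η, ℓ_d)`; `a = 0` or `a = ⊤` (`toReal = 0`) make `s_w = 0` and the
  window empty (vacuous).

Composition `DyadicCoherenceDefect_of` (sorry-free, below): `η` from S1; `ℓ_d, ρ₀″` from
`DefectInWindow` (= S4 S2 S3) at that `η`; `ρ₀′` from S1 at that `ℓ_d`; `ρ₀ = min`; `β = β¹ + β²`
(`Σ ≤ 1/8 + 1/8`); intersect the two eventualities in `N`; `δ = min(δ¹, δ²)`; for a level `m` in
bracket `j` split on `s_w < L/2^m` (S1) or `L/2^m ≤ s_w` (window) and enlarge the budget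
monotonically. The conclusion is the route decl
`Summit.AtomisticToContinuum.BoseEinsteinCondensation.Theses.BECDyadicChaining.DyadicCoherenceDefect` BY NAME.

Disproof used: none exists for this crux (`ledger crux ls stmt-AtomisticToContinuum-13192`: no workfiles,
2026-08-17); negatives index (`ledger negatives --problem AtomisticToContinuum`, 20 entries): none concerns
block occupations / coherence defects (nearest: BECSwapAffinity.SwapJensen, BECPopovBerryRG.BerryStiffPhaseLRO —
unrelated statements). Free gas `v = 0`: S1 must then carry every level (window empty) — consistent with the
route's check "defect ≡ 0 on the free ground state, `δ` below the gap `3π²/L²`".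
-/

noncomputable section

open Filter
open scoped ENNReal NNReal BigOperators

namespace Summit.AtomisticToContinuum.BoseEinsteinCondensation.Cruxes.DyadicCoherenceDefect.Birth

open Literature.MathematicalPhysics.QuantumManyBody.BoseGas
open Summit.AtomisticToContinuum.BoseEinsteinCondensation.Theses

-- BEGIN DEFS

/-- **S1 statement — coherence defect ABOVE the window.** For every repulsive finite-range `v` there is a
window exponent `η ∈ (0, 1/4)` such that for every bracket base `ℓ_d > 0` there is `ρ₀ > 0` with: for
`0 < ρ < ρ₀` a budget `β ≥ 0`, `Σ_j β_j ≤ 1/8`, such that for all large `N`, some `δ > 0` and every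
`δ`-near-minimiser `Ψ` of the Dirichlet box of side `L = (N/ρ)^{1/3}`, every level `m ≥ 1` whose cube side
`L/2^m` lies in `[ℓ_d 2^j, ℓ_d 2^{j+1})` AND exceeds `s_w = (ρa)^{-1/2}(ρa³)^{-η}` (`a = scatteringLength v`,
real part) has `A_m ≤ A_{m-1} + β_j √N`. [cite: arXiv:2603.20776, Rem. 7; Leggett2001, §VI] -/
def DefectAboveWindow : Prop :=
  ∀ v : ℝ → ℝ≥0∞, IsRepulsiveFiniteRange v → ∃ η : ℝ, 0 < η ∧ η < 1 / 4 ∧ ∀ ℓd : ℝ, 0 < ℓd →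
    ∃ ρ₀ : ℝ, 0 < ρ₀ ∧ ∀ ρ : ℝ, 0 < ρ → ρ < ρ₀ →
      ∃ β : ℕ → ℝ, (∀ j, 0 ≤ β j) ∧ Summable β ∧ ∑' j, β j ≤ 1 / 8 ∧ ∀ᶠ N : ℕ in atTop,
        let a : ℝ := (scatteringLength v).toReal
        let L : ℝ := sideLength ρ N
        let φ : (m : ℕ) → (Fin 3 → Fin (2 ^ m)) → EuclideanSpace ℝ (Fin 3) → ℂ := fun m i =>
          Set.indicator {x : EuclideanSpace ℝ (Fin 3) | ∀ k : Fin 3, x k ∈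
              Set.Ioo (((i k : ℕ) : ℝ) * (L / 2 ^ m)) ((((i k : ℕ) : ℝ) + 1) * (L / 2 ^ m))}
            (fun _ => ((Real.sqrt ((L / 2 ^ m) ^ 3))⁻¹ : ℂ))
        ∃ δ : ℝ≥0∞, 0 < δ ∧ ∀ Ψ : TrialState N L, energy v Ψ ≤ groundStateEnergy v N L + δ →
          let A : ℕ → ℝ≥0∞ := fun m => (8 : ℝ≥0∞) ^ (-(m : ℝ) / 2) *
            ∑ i : Fin 3 → Fin (2 ^ m), (occupation N (φ m i) Ψ.ψ) ^ (1 / 2 : ℝ)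
          ∀ m j : ℕ, 1 ≤ m → ℓd * 2 ^ j ≤ L / 2 ^ m → L / 2 ^ m < ℓd * 2 ^ (j + 1) →
            (ρ * a) ^ (-(1 : ℝ) / 2) * (ρ * a ^ 3) ^ (-η) < L / 2 ^ m →
            A m ≤ A (m - 1) + ENNReal.ofReal (β j) * (N : ℝ≥0∞) ^ (1 / 2 : ℝ)

/-- **Window part of the crux — coherence defect INSIDE the window** (derived from S2–S4, not itself a
stub). For every repulsive finite-range `v` and EVERY `η ∈ (0, 1/4)` there are `ℓ_d > 0`, `ρ₀ > 0` with:
for `0 < ρ < ρ₀` a budget `β ≥ 0`, `Σ_j β_j ≤ 1/8`, such that for all large `N`, some `δ > 0` and every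
`δ`-near-minimiser, every level `m ≥ 1` in bracket `j` with cube side `L/2^m ≤ s_w = (ρa)^{-1/2}(ρa³)^{-η}`
has `A_m ≤ A_{m-1} + β_j √N`. [cite: Fournais2020, Thm. 1.2; arXiv:2603.20776, Cor. 6] -/
def DefectInWindow : Prop :=
  ∀ v : ℝ → ℝ≥0∞, IsRepulsiveFiniteRange v → ∀ η : ℝ, 0 < η → η < 1 / 4 → ∃ ℓd : ℝ, 0 < ℓd ∧
    ∃ ρ₀ : ℝ, 0 < ρ₀ ∧ ∀ ρ : ℝ, 0 < ρ → ρ < ρ₀ →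
      ∃ β : ℕ → ℝ, (∀ j, 0 ≤ β j) ∧ Summable β ∧ ∑' j, β j ≤ 1 / 8 ∧ ∀ᶠ N : ℕ in atTop,
        let a : ℝ := (scatteringLength v).toReal
        let L : ℝ := sideLength ρ N
        let φ : (m : ℕ) → (Fin 3 → Fin (2 ^ m)) → EuclideanSpace ℝ (Fin 3) → ℂ := fun m i =>
          Set.indicator {x : EuclideanSpace ℝ (Fin 3) | ∀ k : Fin 3, x k ∈
              Set.Ioo (((i k : ℕ) : ℝ) * (L / 2 ^ m)) ((((i k : ℕ) : ℝ) + 1) * (L / 2 ^ m))}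
            (fun _ => ((Real.sqrt ((L / 2 ^ m) ^ 3))⁻¹ : ℂ))
        ∃ δ : ℝ≥0∞, 0 < δ ∧ ∀ Ψ : TrialState N L, energy v Ψ ≤ groundStateEnergy v N L + δ →
          let A : ℕ → ℝ≥0∞ := fun m => (8 : ℝ≥0∞) ^ (-(m : ℝ) / 2) *
            ∑ i : Fin 3 → Fin (2 ^ m), (occupation N (φ m i) Ψ.ψ) ^ (1 / 2 : ℝ)
          ∀ m j : ℕ, 1 ≤ m → ℓd * 2 ^ j ≤ L / 2 ^ m → L / 2 ^ m < ℓd * 2 ^ (j + 1) →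
            L / 2 ^ m ≤ (ρ * a) ^ (-(1 : ℝ) / 2) * (ρ * a ^ 3) ^ (-η) →
            A m ≤ A (m - 1) + ENNReal.ofReal (β j) * (N : ℝ≥0∞) ^ (1 / 2 : ℝ)

/-- **S2 statement — the level-occupation ladder and the increment bound.** For every `N`, `L`, every
Dirichlet trial state `Ψ` and every level `m ≥ 1`, with `T_m = Σ_{C ∈ level m} ⟨φ_C, γ_Ψ φ_C⟩` (open
dyadic cubes of side `L/2^m`, flat modes) and `A_m = 8^{-m/2} Σ_C √⟨φ_C, γ_Ψ φ_C⟩`: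
`T_{m-1} ≤ T_m ≤ N` and `A_m ≤ A_{m-1} + √(T_m − T_{m-1})` (truncated subtraction in `ℝ≥0∞`). The first two
are `cohSum_le_cohSum_succ` / `cohSum_le_card` transported along `openCell_ae_eq_dyCell`; the third is
`Σ_C‖u_C‖ − ‖Σ_C u_C‖ ≤ √(8(Σ_C‖u_C‖² − 8‖u_P‖²/1))` per parent (`√x − √y ≤ √(x−y)`, Cauchy–Schwarz) and
Cauchy–Schwarz over the `8^{m-1}` parents. [cite: LSSY2005, §1.2 (1.17)] -/
def LevelIncrement : Prop :=
  ∀ (N : ℕ) (L : ℝ) (Ψ : TrialState N L) (m : ℕ), 1 ≤ m →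
    let φ : (m : ℕ) → (Fin 3 → Fin (2 ^ m)) → EuclideanSpace ℝ (Fin 3) → ℂ := fun m i =>
      Set.indicator {x : EuclideanSpace ℝ (Fin 3) | ∀ k : Fin 3, x k ∈
          Set.Ioo (((i k : ℕ) : ℝ) * (L / 2 ^ m)) ((((i k : ℕ) : ℝ) + 1) * (L / 2 ^ m))}
        (fun _ => ((Real.sqrt ((L / 2 ^ m) ^ 3))⁻¹ : ℂ))
    let T : ℕ → ℝ≥0∞ := fun m => ∑ i : Fin 3 → Fin (2 ^ m), occupation N (φ m i) Ψ.ψ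
    let A : ℕ → ℝ≥0∞ := fun m => (8 : ℝ≥0∞) ^ (-(m : ℝ) / 2) *
      ∑ i : Fin 3 → Fin (2 ^ m), (occupation N (φ m i) Ψ.ψ) ^ (1 / 2 : ℝ)
    T (m - 1) ≤ T m ∧ T m ≤ N ∧ A m ≤ A (m - 1) + (T m - T (m - 1)) ^ (1 / 2 : ℝ)

/-- **S4 statement — the window budget.** The level ladder (S2) and local condensation on all window
scales (S3 = `BECDyadicChaining.WindowLocalCondensation`) give the window part of the crux with budget
`Σ ≤ 1/8`: per window level `defect_m ≤ √(T_m − T_{m-1}) ≤ √(N − T_{m-1}) ≤ √(C'(ρa³)^{γ'} max(1, 4ρa s_m²)) √N`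
(S3 at a second exponent `η' ∈ (η, 1/4)`), summed over the `≲ log₂(s_w/ℓ_d)` window brackets:
`≲ √C'(ρa³)^{γ'/2}(log₂(s_w/ℓ_d) + 1 + 8(ρa³)^{-η}) → 0` as `ρ → 0` since `γ' > 2η`.
[cite: Fournais2020, Thm. 1.2; arXiv:2603.20776, Cor. 6 and Rem. 5] -/
def WindowBudget : Prop :=
  LevelIncrement → BECDyadicChaining.WindowLocalCondensation → DefectInWindow

-- END DEFS

/-! ## Audit aliases: the composition's hypotheses are the declared stubs BY NAME

The skeleton audit admits a hypothesis whose head constant's last name component is a declared stub name;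
the aliases live in the implementation-detail namespace `__Goal` so that the audit's stub table resolves each
`stub_*` to the sorried THEOREM below (its signature), never to the alias. -/

namespace __Goal

/-- Audit alias of stub S1 (`stub_defectAboveWindow`): the statement `DefectAboveWindow`. [folklore] -/
abbrev stub_defectAboveWindow : Prop := DefectAboveWindow

/-- Audit alias of stub S2 (`stub_levelIncrement`): the statement `LevelIncrement`. [folklore] -/
abbrev stub_levelIncrement : Prop := LevelIncrement

/-- Audit alias of stub S3 (`stub_windowLocalCondensation`): the route item
`BECDyadicChaining.WindowLocalCondensation` (stmt-AtomisticToContinuum-13194). [folklore] -/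
abbrev stub_windowLocalCondensation : Prop := BECDyadicChaining.WindowLocalCondensation

/-- Audit alias of stub S4 (`stub_windowBudget`): the statement `WindowBudget`. [folklore] -/
abbrev stub_windowBudget : Prop := WindowBudget

end __Goal

/-! ## Registered stubs (the ONLY `sorry`s of this file) -/

/-- **Stub S1 (XL/open, HARDEST): coherence defect above the window** — see `DefectAboveWindow`.
[cite: arXiv:2603.20776, Rem. 7; Leggett2001, §VI] -/
theorem stub_defectAboveWindow : DefectAboveWindow := by
  sorry

/-- **Stub S2 (M, provable now): level-occupation ladder and increment bound** — see `LevelIncrement`.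
[cite: LSSY2005, §1.2 (1.17)] -/
theorem stub_levelIncrement : LevelIncrement := by
  sorry

/-- **Stub S3 (XL): local condensation on all window scales** — the route item
`BECDyadicChaining.WindowLocalCondensation` (stmt-AtomisticToContinuum-13194) by name.
[cite: Fournais2020, Thm. 1.2; arXiv:2603.20776, Cor. 6] -/
theorem stub_windowLocalCondensation : BECDyadicChaining.WindowLocalCondensation := by
  sorry

/-- **Stub S4 (M/L): the window budget** — see `WindowBudget`. [cite: Fournais2020, Thm. 1.2] -/
theorem stub_windowBudget : WindowBudget := by
  sorry

/-! ## Composition (sorry-free): the four stubs give the crux BY NAME -/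

/-- **`DyadicCoherenceDefect` from the four stubs.** Hypotheses = the four declared stubs BY NAME (`__Goal.stub_*` aliases; S3 as the registered route item); conclusion =
the route decl `BECDyadicChaining.DyadicCoherenceDefect`. Glue: `η` from S1, `ℓ_d` from the window part
(S4 S2 S3) at that `η`, `ρ₀ = min`, `β = β¹ + β²`, eventualities intersected, `δ = min`, and a case split
`s_w < L/2^m` / `L/2^m ≤ s_w` per level. [folklore] -/
theorem DyadicCoherenceDefect_of :
    __Goal.stub_defectAboveWindow → __Goal.stub_levelIncrement → BECDyadicChaining.WindowLocalCondensation →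
      __Goal.stub_windowBudget → BECDyadicChaining.DyadicCoherenceDefect := by
  intro hU hI hWLC hWB
  have hW : DefectInWindow := hWB hI hWLC
  intro v hv
  obtain ⟨η, hη0, hη4, HU⟩ := hU v hv
  obtain ⟨ℓd, hℓd, ρ₂, hρ₂, HW⟩ := hW v hv η hη0 hη4
  obtain ⟨ρ₁, hρ₁, HU'⟩ := HU ℓd hℓd
  refine ⟨ℓd, hℓd, min ρ₁ ρ₂, lt_min hρ₁ hρ₂, fun ρ hρ hρlt => ?_⟩
  obtain ⟨β₁, hβ₁0, hβ₁s, hβ₁t, E1⟩ := HU' ρ hρ (hρlt.trans_le (min_le_left _ _))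
  obtain ⟨β₂, hβ₂0, hβ₂s, hβ₂t, E2⟩ := HW ρ hρ (hρlt.trans_le (min_le_right _ _))
  refine ⟨fun j => β₁ j + β₂ j, fun j => add_nonneg (hβ₁0 j) (hβ₂0 j), hβ₁s.add hβ₂s, ?_, ?_⟩
  · show ∑' j, (β₁ j + β₂ j) ≤ 1 / 4
    rw [hβ₁s.tsum_add hβ₂s]
    linarith
  filter_upwards [E1, E2] with N hN1 hN2
  obtain ⟨δ₁, hδ₁, HΨ1⟩ := hN1
  obtain ⟨δ₂, hδ₂, HΨ2⟩ := hN2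
  refine ⟨min δ₁ δ₂, lt_min hδ₁ hδ₂, fun Ψ hΨ => ?_⟩
  have h1 := HΨ1 Ψ (hΨ.trans (add_le_add le_rfl (min_le_left _ _)))
  have h2 := HΨ2 Ψ (hΨ.trans (add_le_add le_rfl (min_le_right _ _)))
  intro A m j hm hj1 hj2
  rcases lt_or_ge ((ρ * (scatteringLength v).toReal) ^ (-(1 : ℝ) / 2) *
      (ρ * (scatteringLength v).toReal ^ 3) ^ (-η)) (sideLength ρ N / 2 ^ m) with hup | hin
  · exact (h1 m j hm hj1 hj2 hup).trans (add_le_add le_rfl (mul_le_mul'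
      (ENNReal.ofReal_le_ofReal (le_add_of_nonneg_right (hβ₂0 j))) le_rfl))
  · exact (h2 m j hm hj1 hj2 hin).trans (add_le_add le_rfl (mul_le_mul'
      (ENNReal.ofReal_le_ofReal (le_add_of_nonneg_left (hβ₁0 j))) le_rfl))

end Summit.AtomisticToContinuum.BoseEinsteinCondensation.Cruxes.DyadicCoherenceDefect.Birth

end
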